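import Mathlib
import Summits.Langlands.Langlands.Statement
import Summits.Langlands.Langlands.Theorems.SoloInformedPstSpecTwist
import Literature.NumberTheory.Automorphic.LocalComponentBJUniqueProofs
import Literature.NumberTheory.Automorphic.AutomorphicRepsGLSatakeFlathProofs
import Literature.NumberTheory.Automorphic.GLnAdelicStructureProofs
import Literature.NumberTheory.Automorphic.GKModulesAdmissible
import Literature.NumberTheory.Automorphic.TunnellLemma
import Literature.NumberTheory.GaloisRepresentations.LAdicRepFrobenius
import Literature.NumberTheory.GaloisRepresentations.FramedRepEquivConj
import Literature.NumberTheory.GaloisRepresentations.LocalKroneckerWeberInertiaProofs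
import Literature.NumberTheory.GaloisRepresentations.PstWeilDeligneCyclotomicWeight
import Literature.NumberTheory.GaloisRepresentations.OrdinaryGaloisRep
import Literature.FieldTheory.AlgClosed.PadicAlgClEquivComplex
import HarnessLib

/-!
# Pin exclusion: the summit is not invariant under a specification-preserving change of the `v ∣ ℓ` datum

Solo seat `solo-Langlands-informed`, s58 — kernel form of the statement-level finding of s48–s50.
The `v ∣ ℓ` clause of `LocalGlobalCompatibleAt` reads Fontaine's datum
`𝓡.pst ℓ v hv = fontainePstAdicCompletion v ℓ hv`, Hilbert's `ε` over the clauses `IsFontaineDatum`;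
`SoloInformedPstSpecTwist` proved that these clauses do not determine the Weil–Deligne class attached
to the cyclotomic character.  Here the dependence of the SUMMIT on that choice becomes a theorem:
the summit text is rewritten with the pin replaced by a parameter `D : DatumFamily K` (one
`PstWeilDeligneData (K_v) ℓ` per `ℓ` and `v ∣ ℓ`), giving `LocalGlobalCompatibleAtWith D`, …,
`GLCWith D`, `LanglandsWith D`; for the pinned family `pstFamily` each IS the summit declaration by
`Iff.rfl` (`glcWith_pstFamily_iff`, `langlandsWith_pstFamily_iff`).  Results:
* `not_galoisToAutomorphicWith_and_automorphicToGaloisWith_twist` (rank 1, every `K`, `𝓡`, `ℓ`,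
  `v₀ ∣ ℓ`, every `D` making `ε_ℓ` de Rham above `ℓ` = clause (F2)): (B) for `D` and (A) for
  `twistFamily D` (`twistOff (D ℓ v hv) 2` everywhere) are not both true.  Proof: (B) gives a
  cuspidal `π` corresponding to `ρ₀ = ε_ℓ`; (A) for the twisted family gives `ρ₂` corresponding to
  `π`; Flath's uniqueness of Satake parameters + Chebotarev–Brauer–Nesbitt
  (`nonempty_equiv_of_hasFrobCharpolyAt_eventually`, `exists_eq_conj_of_equiv`) make `ρ₂` a frame
  change of `ρ₀`; at `v₀` both clauses name the same local component class (Borel–Jacquet,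
  `hasLocalComponentAt_unique_holds`), hence the same `rec`-class, hence — rank one: Frobenius-
  semisimplification is the identity, transport along `ι` is injective on determinant characters —
  isomorphic Weil–Deligne representations over `ℚ̄_ℓ`, one attached to `ε_ℓ|Γ_{K_{v₀}}` by `D`, the
  other by its twist: contradiction with `PstSpecTwist.twistOff_disagree`.
* `not_glc_and_glcWith_twist_pstFamily`, `not_langlands_and_langlandsWith_twist` (pinned family,
  under Fontaine's existence theorem `FontaineDatumExists`, which makes the pin meet (F2)):
  `Langlands` and `LanglandsWith (twist ∘ pst)` are not both true, although the twisted pin meets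
  every clause the `ε` in `fontainePst` is chosen over (`isFontaineDatum_twistFamily_pstFamily`): the
  truth value of the summit as typed depends on WHICH witness of `IsFontaineDatum` the `ε`-term
  denotes — information absent from the tree until definition item D2 (`WD ∘ D_pst`) replaces the pin
  by a construction.  No new axioms; every ingredient is a theorem of the tree.
-/

open scoped MatrixGroups Matrix NumberField Classical
open NumberField IsDedekindDomain Field Filter ValuativeRel
open Literature.NumberTheory.Automorphic Literature.NumberTheory.GaloisRepresentations
  Literature.NumberTheory.PAdicHodge

noncomputable section

namespace Summit.Langlands.Langlands.Theorems
namespace PinExclusion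

section RankOne

variable {C : Type*} [Field C]

/-- In rank one the determinant is the single matrix entry. [folklore] -/
theorem det_eq_entry (f : Module.End C (Fin 1 → C)) :
    LinearMap.det f = LinearMap.toMatrix' f 0 0 := by
  rw [← LinearMap.det_toMatrix', Matrix.det_fin_one]

/-- Endomorphisms of a line are determined by their determinant. [folklore] -/
theorem linearMap_eq_of_det_eq {f g : Module.End C (Fin 1 → C)}
    (h : LinearMap.det f = LinearMap.det g) : f = g :=
  LinearMap.toMatrix'.injective (Matrix.ext fun i j => by
    obtain rfl : i = 0 := Subsingleton.elim _ _
    obtain rfl : j = 0 := Subsingleton.elim _ _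
    rw [← det_eq_entry, ← det_eq_entry, h])

/-- A nilpotent endomorphism of a line is `0` (its determinant is nilpotent). [folklore] -/
theorem eq_zero_of_isNilpotent {f : Module.End C (Fin 1 → C)} (h : IsNilpotent f) : f = 0 := by
  obtain ⟨k, hk⟩ := h
  refine linearMap_eq_of_det_eq (g := 0) ?_
  rw [LinearMap.det_zero, Module.finrank_fin_fun, pow_one]
  exact IsNilpotent.eq_zero ⟨k, by rw [← map_pow, hk, LinearMap.det_zero, Module.finrank_fin_fun, pow_one]⟩

variable [CharZero C] {F : Type} [Field F] [ValuativeRel F] [TopologicalSpace F]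
  [IsNonarchimedeanLocalField F]

/-- Isomorphic Weil–Deligne representations on one space have the same determinant character
`w ↦ det ρ(w)`. [folklore] -/
theorem det_ρ_eq_of_isEquivalent {V : Type*} [AddCommGroup V] [Module C V]
    {r r' : WeilDeligneRep F C V} (h : r.IsEquivalent r') (w : WeilGroup F) :
    LinearMap.det (r.ρ w) = LinearMap.det (r'.ρ w) := by
  obtain ⟨e⟩ := h
  have h1 := congrArg LinearMap.det (e.isIntertwining' w)
  rw [LinearMap.det_comp, LinearMap.det_comp, mul_comm] at h1
  have he : IsUnit (LinearMap.det (e.toLinearEquiv : V →ₗ[C] V)) :=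
    LinearMap.isUnit_det _ ((Module.End.isUnit_iff _).mpr e.toLinearEquiv.bijective)
  exact he.mul_right_cancel h1

/-- Transport along `ι` maps the determinant character by `ι`. [folklore] -/
theorem det_ρ_of_isTransportAlong {E : Type*} [Field E] [CharZero E] {n : ℕ} {ι : E →+* C}
    {r : WeilDeligneRep F E (Fin n → E)} {r' : WeilDeligneRep F C (Fin n → C)}
    (h : r.IsTransportAlong ι r') (w : WeilGroup F) :
    LinearMap.det (r'.ρ w) = ι (LinearMap.det (r.ρ w)) := by
  rw [← LinearMap.det_toMatrix', h.1 w, ← LinearMap.det_toMatrix', RingHom.map_det,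
    RingHom.mapMatrix_apply]

/-- In rank one a Frobenius-semisimplification has the same determinant character (the nilpotent
correction vanishes). [folklore] -/
theorem det_ρ_eq_of_isFrobSemisimplificationOf {r' r : WeilDeligneRep F C (Fin 1 → C)}
    (h : r'.IsFrobSemisimplificationOf r) (w : WeilGroup F) :
    LinearMap.det (r'.ρ w) = LinearMap.det (r.ρ w) := by
  obtain ⟨-, -, hw⟩ := h
  obtain ⟨-, m, hm, -, heq⟩ := hw w
  rw [heq, eq_zero_of_isNilpotent hm, add_zero]

/-- In rank one, Weil–Deligne representations with the same determinant character are EQUAL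
(`N = 0` on a line), hence isomorphic. [folklore] -/
theorem isEquivalent_of_det_ρ_eq {r r' : WeilDeligneRep F C (Fin 1 → C)}
    (h : ∀ w, LinearMap.det (r.ρ w) = LinearMap.det (r'.ρ w)) : r.IsEquivalent r' := by
  have hρ : r.ρ = r'.ρ := MonoidHom.ext fun w => linearMap_eq_of_det_eq (h w)
  have hN : r.N = r'.N := by
    rw [eq_zero_of_isNilpotent r.isNilpotent_N, eq_zero_of_isNilpotent r'.isNilpotent_N]
  suffices hrr' : r = r' by rw [hrr']; exact WeilDeligneRep.IsEquivalent.refl r'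
  obtain ⟨ρ₁, c₁, N₁, n₁, w₁⟩ := r
  obtain ⟨ρ₂, c₂, N₂, n₂, w₂⟩ := r'
  dsimp only at hρ hN
  subst hρ hN
  rfl

end RankOne

section Cyclotomic

variable (K : Type) [Field K] [NumberField K] (ℓ : ℕ) [Fact ℓ.Prime]

/-- Restricting the cyclotomic character of `Γ_K` to `Γ_{K_v}` gives the cyclotomic character of
`Γ_{K_v}` (`cyclotomicCharacter_absGaloisRestrict`). [folklore] -/
theorem toLocal_cyclotomicPadicAlgCl (v : HeightOneSpectrum (𝓞 K)) :
    FramedGaloisRep.toLocal v (FramedGaloisRep.cyclotomicPadicAlgCl K ℓ) =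
      FramedGaloisRep.cyclotomicPadicAlgCl (v.adicCompletion K) ℓ := by
  haveI : NeZero (ℓ : K) := ⟨Nat.cast_ne_zero.mpr (Fact.out : ℓ.Prime).ne_zero⟩
  refine ContinuousMonoidHom.ext fun σ => Units.ext (Matrix.ext fun i j => ?_)
  rw [FramedGaloisRep.toLocal_apply, FramedGaloisRep.cyclotomicPadicAlgCl_apply_coe,
    FramedGaloisRep.cyclotomicPadicAlgCl_apply_coe, cyclotomicCharacter_absGaloisRestrict]

/-- The cyclotomic character `Γ_K → GL₁(ℚ̄_ℓ)` is unramified at the `v ∤ ℓ`. [folklore] -/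
theorem eventually_isUnramifiedAt_cyclotomicPadicAlgCl :
    ∀ᶠ v : HeightOneSpectrum (𝓞 K) in cofinite,
      FramedGaloisRep.IsUnramifiedAt v (FramedGaloisRep.cyclotomicPadicAlgCl K ℓ) := by
  have hI : Ideal.span {((ℓ : ℕ) : 𝓞 K)} ≠ ⊥ := by
    rw [Ne, Ideal.span_singleton_eq_bot]
    exact Nat.cast_ne_zero.mpr (Fact.out : ℓ.Prime).ne_zero
  have hinj : Function.Injective (padicIntToPadicAlgCl ℓ) := fun x y h => by
    rw [padicIntToPadicAlgCl_apply, padicIntToPadicAlgCl_apply] at h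
    exact PadicInt.ext ((algebraMap ℚ_[ℓ] (PadicAlgCl ℓ)).injective h)
  have hf : ∀ᶠ v : HeightOneSpectrum (𝓞 K) in cofinite, ((ℓ : ℕ) : 𝓞 K) ∉ v.asIdeal := by
    rw [Filter.eventually_cofinite]
    refine (Ideal.finite_factors hI).subset fun v hv => ?_
    simp only [Set.mem_setOf_eq, not_not] at hv ⊢
    exact (Ideal.dvd_span_singleton).mpr hv
  exact hf.mono fun v hv => (FramedGaloisRep.isUnramifiedAt_baseChange_iff _ _ hinj v _).2
    (FramedGaloisRep.isUnramifiedAt_cyclotomic_holds K ℓ hv)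

/-- Some place of `K` lies above `ℓ`. [folklore] -/
theorem exists_natCast_mem_asIdeal :
    ∃ v : HeightOneSpectrum (𝓞 K), ((ℓ : ℕ) : 𝓞 K) ∈ v.asIdeal := by
  have hℓ : (ℓ : ℕ).Prime := Fact.out
  haveI hp : (Ideal.span {(ℓ : ℤ)}).IsPrime :=
    (Ideal.span_singleton_prime (by exact_mod_cast hℓ.ne_zero)).2 (Nat.prime_iff_prime_int.1 hℓ)
  obtain ⟨⟨P, hP, hover⟩⟩ := (Ideal.span {(ℓ : ℤ)}).nonempty_primesOver (S := 𝓞 K)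
  have h1 : (ℓ : ℤ) ∈ P.under ℤ := hover.over ▸ Ideal.mem_span_singleton_self (ℓ : ℤ)
  change (ℓ : ℤ) ∈ Ideal.comap (algebraMap ℤ (𝓞 K)) P at h1
  rw [Ideal.mem_comap, map_natCast] at h1
  refine ⟨⟨P, hP, fun h => ?_⟩, h1⟩
  rw [h, Ideal.mem_bot] at h1
  exact Nat.cast_ne_zero.mpr hℓ.ne_zero h1

omit [NumberField K] in
/-- A rank-one Galois representation over `ℚ̄_ℓ` is semisimple (it is irreducible:
`isIrreducible_of_finrank_eq_one'`, landed as `IrreducibleOffSector.isIrreducible_of_rank_one`).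
[folklore] -/
theorem isSemisimple_of_rank_one (ρ : FramedGaloisRep K (PadicAlgCl ℓ) 1) :
    ρ.toGaloisRep.IsSemisimple := by
  haveI : Representation.IsIrreducible ρ.toGaloisRep.toRepresentation :=
    isIrreducible_of_finrank_eq_one' _ (Module.finrank_fin_fun _)
  change Representation.IsSemisimpleRepresentation ρ.toGaloisRep.toRepresentation
  infer_instance

end Cyclotomic

section Shadow

/-- **A family of `p`-adic Hodge data** for `K`: one `PstWeilDeligneData (K_v) ℓ` per prime `ℓ`
and place `v ∣ ℓ` — the TYPE of the pin `fun ℓ _ v hv => 𝓡.pst ℓ v hv`. [folklore] -/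
abbrev DatumFamily (K : Type) [Field K] [NumberField K] : Type 1 :=
  ∀ (ℓ : ℕ) [Fact ℓ.Prime] (v : HeightOneSpectrum (𝓞 K)),
    ((ℓ : ℕ) : 𝓞 K) ∈ v.asIdeal → PstWeilDeligneData (v.adicCompletion K) ℓ

/-- **The pinned family** `fontainePstAdicCompletion v ℓ hv` (= `𝓡.pst ℓ v hv`, any `𝓡`). [folklore] -/
def pstFamily (K : Type) [Field K] [NumberField K] : DatumFamily K :=
  fun ℓ _ v hv => fontainePstAdicCompletion v ℓ hv

/-- **The twisted family**: the specification-twin `PstSpecTwist.twistOff (D ℓ v hv) 2` at every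
place above every `ℓ`. [folklore] -/
def twistFamily {K : Type} [Field K] [NumberField K] (D : DatumFamily K) : DatumFamily K :=
  fun ℓ _ v hv => PstSpecTwist.twistOff (D ℓ v hv) (Units.mk0 2 two_ne_zero)

variable {n : ℕ} {K : Type} [Field K] [NumberField K] {hcpt : isCompact_glFiniteIntegralLevel n K}
  {ℓ : ℕ} [Fact ℓ.Prime]

/-- `LocalGlobalCompatibleAt` with the `v ∣ ℓ` datum `D ℓ v hv` in place of the pin (text
otherwise verbatim). [cite: HarrisTaylorAMS2001, Thm. A] -/
def LocalGlobalCompatibleAtWith (D : DatumFamily K) (𝓡 : ReciprocityData K)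
    (ι : PadicAlgCl ℓ ≃+* ℂ) (π : AutomorphicRepData (AutomorphyDatum.gl n K hcpt))
    (ρ : FramedGaloisRep K (PadicAlgCl ℓ) n) (v : HeightOneSpectrum (𝓞 K)) : Prop :=
  ∃ (πv : SmoothIrrep (GL (Fin n) (v.adicCompletion K)))
    (r : WeilDeligneRep (v.adicCompletion K) (PadicAlgCl ℓ) (Fin n → PadicAlgCl ℓ))
    (rℂ : WeilDeligneRep (v.adicCompletion K) ℂ (Fin n → ℂ)),
    π.HasLocalComponentAt v πv.ρ ∧
    (((ℓ : ℕ) : 𝓞 K) ∉ v.asIdeal → IsWeilDeligneOfLadic (ρ.toLocal v).toWeilGroupHom r) ∧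
    (∀ hv : ((ℓ : ℕ) : 𝓞 K) ∈ v.asIdeal, (D ℓ v hv).IsWeilDeligneOf (ρ.toLocal v) r) ∧
    r.IsTransportAlong (ι : PadicAlgCl ℓ →+* ℂ) rℂ ∧
    rℂ.HasFrobSemisimpleClass ((𝓡.llc v).recGL n (IrrClass.mk πv))

/-- `Corresponds` with the datum family `D`. [cite: BuzzardGeeLMS2014, Conj. 3.2.1–3.2.2] -/
def CorrespondsWith (D : DatumFamily K) (𝓡 : ReciprocityData K) (ι : PadicAlgCl ℓ ≃+* ℂ)
    (π : AutomorphicRepData (AutomorphyDatum.gl n K hcpt))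
    (ρ : FramedGaloisRep K (PadicAlgCl ℓ) n) : Prop :=
  (∀ᶠ v : HeightOneSpectrum (𝓞 K) in cofinite, SatakeFrobCompatibleAt ι π ρ v) ∧
    ∀ v : HeightOneSpectrum (𝓞 K), LocalGlobalCompatibleAtWith D 𝓡 ι π ρ v

/-- `IsGeometricFramed` with the datum family `D`. [cite: FontaineMazurGeometric1995, §1] -/
def IsGeometricFramedWith (D : DatumFamily K) (ρ : FramedGaloisRep K (PadicAlgCl ℓ) n) : Prop :=
  (∀ᶠ v : HeightOneSpectrum (𝓞 K) in cofinite, ρ.IsUnramifiedAt v) ∧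
    ∀ (v : HeightOneSpectrum (𝓞 K)) (hv : ((ℓ : ℕ) : 𝓞 K) ∈ v.asIdeal),
      (D ℓ v hv).IsDeRhamFramed (ρ.toLocal v)

variable (n) in
/-- Direction (A) with the datum family `D`. [cite: BuzzardGeeLMS2014, Conj. 3.2.1 and Conj. 3.2.2] -/
def AutomorphicToGaloisWith (D : DatumFamily K) (𝓡 : ReciprocityData K)
    (hcpt : isCompact_glFiniteIntegralLevel n K) : Prop :=
  ∀ π : CuspidalAutomorphicRepData n K hcpt, π.1.IsLAlgebraic →
    ∀ (ℓ : ℕ) [Fact ℓ.Prime] (ι : PadicAlgCl ℓ ≃+* ℂ),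
      ∃ ρ : FramedGaloisRep K (PadicAlgCl ℓ) n,
        ρ.toGaloisRep.IsIrreducible ∧ IsGeometricFramedWith D ρ ∧ CorrespondsWith D 𝓡 ι π.1 ρ ∧
          ∀ ρ' : FramedGaloisRep K (PadicAlgCl ℓ) n, CorrespondsWith D 𝓡 ι π.1 ρ' → IsConjugate ρ ρ'

variable (n) in
/-- Direction (B) with the datum family `D`. [cite: FontaineMazurGeometric1995, Conj. 1] -/
def GaloisToAutomorphicWith (D : DatumFamily K) (𝓡 : ReciprocityData K)
    (hcpt : isCompact_glFiniteIntegralLevel n K) : Prop :=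
  ∀ (ℓ : ℕ) [Fact ℓ.Prime] (ι : PadicAlgCl ℓ ≃+* ℂ) (ρ : FramedGaloisRep K (PadicAlgCl ℓ) n),
    ρ.toGaloisRep.IsIrreducible → IsGeometricFramedWith D ρ →
      ∃ π : CuspidalAutomorphicRepData n K hcpt, π.1.IsLAlgebraic ∧ CorrespondsWith D 𝓡 ι π.1 ρ

variable (n K) in
/-- `GlobalLanglandsCorrespondenceGLn` with the datum family `D`. [cite: BuzzardGeeLMS2014, Conj. 3.2.2] -/
def GLCWith (D : DatumFamily K) (𝓡 : ReciprocityData K)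
    (hcpt : isCompact_glFiniteIntegralLevel n K) : Prop :=
  AutomorphicToGaloisWith n D 𝓡 hcpt ∧ GaloisToAutomorphicWith n D 𝓡 hcpt

/-- `Langlands` with a datum family for every number field. [cite: BuzzardGeeLMS2014, Conj. 3.2.2] -/
def LanglandsWith (D : ∀ (K : Type) [Field K] [NumberField K], DatumFamily K) : Prop :=
  ∀ (F : Type) [Field F] [NumberField F],
    Nonempty (ReciprocityData F) ∧
      ∀ (𝓡 : ReciprocityData F) (n : ℕ), 0 < n →
        ∀ hcpt : isCompact_glFiniteIntegralLevel n F, GLCWith n F (D F) 𝓡 hcpt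

/-- For the pinned family, `GLCWith` IS `GlobalLanglandsCorrespondenceGLn` (likewise every other
shadow, by `Iff.rfl`). [folklore] -/
theorem glcWith_pstFamily_iff (𝓡 : ReciprocityData K) (hcpt : isCompact_glFiniteIntegralLevel n K) :
    GLCWith n K (pstFamily K) 𝓡 hcpt ↔ GlobalLanglandsCorrespondenceGLn n K 𝓡 hcpt :=
  Iff.rfl

/-- For the pinned families, `LanglandsWith` IS the summit `Langlands`. [folklore] -/
theorem langlandsWith_pstFamily_iff : LanglandsWith (fun K _ _ => pstFamily K) ↔ Langlands :=
  Iff.rfl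

end Shadow

section Main

variable {K : Type} [Field K] [NumberField K]

/-- **Pin exclusion** (rank one).  For a family `D` of `p`-adic Hodge data making the cyclotomic
character de Rham above `ℓ` (clause (F2)), direction (B) relative to `D` and direction (A) relative
to the twisted family `twistFamily D` are not both true. [folklore] -/
theorem not_galoisToAutomorphicWith_and_automorphicToGaloisWith_twist (𝓡 : ReciprocityData K)
    (hcpt : isCompact_glFiniteIntegralLevel 1 K) (D : DatumFamily K) (ℓ : ℕ) [Fact ℓ.Prime]
    (v₀ : HeightOneSpectrum (𝓞 K)) (hv₀ : ((ℓ : ℕ) : 𝓞 K) ∈ v₀.asIdeal)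
    (HD : ∀ (v : HeightOneSpectrum (𝓞 K)) (hv : ((ℓ : ℕ) : 𝓞 K) ∈ v.asIdeal),
      (D ℓ v hv).IsDeRhamFramed (FramedGaloisRep.cyclotomicPadicAlgCl (v.adicCompletion K) ℓ)) :
    ¬ (GaloisToAutomorphicWith 1 D 𝓡 hcpt ∧ AutomorphicToGaloisWith 1 (twistFamily D) 𝓡 hcpt) := by
  rintro ⟨hB, hA⟩
  obtain ⟨ι⟩ := PadicAlgCl.nonempty_ringEquiv_complex ℓ
  obtain ⟨ρ₀, hρ₀⟩ :
      ∃ ρ₀ : FramedGaloisRep K (PadicAlgCl ℓ) 1, ρ₀ = FramedGaloisRep.cyclotomicPadicAlgCl K ℓ :=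
    ⟨_, rfl⟩
  -- (B) for `D` on the cyclotomic character: a cuspidal `π` of `GL₁(𝔸_K)`
  obtain ⟨π, hπalg, hπ⟩ := hB ℓ ι ρ₀ (isIrreducible_of_finrank_eq_one' _ (Module.finrank_fin_fun _))
    ⟨by rw [hρ₀]; exact eventually_isUnramifiedAt_cyclotomicPadicAlgCl K ℓ,
      fun v hv => by rw [hρ₀, toLocal_cyclotomicPadicAlgCl]; exact HD v hv⟩
  -- (A) for the twisted family on `π`
  obtain ⟨ρ₂, -, -, hρ₂, -⟩ := hA π hπalg ℓ ι
  -- `ρ₂` is a frame change of `ρ₀` (Flath's uniqueness of Satake parameters + Chebotarev +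
  -- Brauer–Nesbitt)
  obtain ⟨e₀⟩ := FramedGaloisRep.nonempty_equiv_of_hasFrobCharpolyAt_eventually
    chebotarev_artinRep_of_galoisSide ρ₀ ρ₂ (isSemisimple_of_rank_one K ℓ ρ₀)
    (isSemisimple_of_rank_one K ℓ ρ₂) ((hπ.1.and hρ₂.1).mono fun v hv => by
      obtain ⟨⟨α, hα, hu, hP⟩, ⟨β, hβ, hu', hP'⟩⟩ := hv
      obtain rfl : α = β := AutomorphicRepData.hasSatakeParamAt_unique_holds π.1 hα hβ
      exact ⟨hu, hu', _, hP, hP'⟩)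
  obtain ⟨P, hP⟩ := FramedRep.exists_eq_conj_of_equiv ρ₀ ρ₂ e₀
  -- the two local–global clauses at `v₀` name the same `rec`-class
  obtain ⟨πv, r, rℂ, hπv, -, hr, hT, hc⟩ := hπ.2 v₀
  obtain ⟨πv', r', rℂ', hπv', -, hr', hT', hc'⟩ := hρ₂.2 v₀
  have hcl : IrrClass.mk πv = IrrClass.mk πv' :=
    AutomorphicRepData.hasLocalComponentAt_unique_holds π.1 v₀ πv πv' hπv hπv'
  obtain ⟨s, hs, hsc⟩ := hc
  obtain ⟨s', hs', hsc'⟩ := hc'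
  rw [hcl] at hsc
  have e : s.IsEquivalent s' := Quotient.exact (hsc.trans hsc'.symm)
  -- so the determinant characters of `r` and `r'` agree, hence `r ≅ r'` (rank one)
  have hdet : ∀ w, LinearMap.det (r.ρ w) = LinearMap.det (r'.ρ w) := fun w =>
    (ι : PadicAlgCl ℓ →+* ℂ).injective (by
      rw [← det_ρ_of_isTransportAlong hT w, ← det_ρ_of_isTransportAlong hT' w,
        ← det_ρ_eq_of_isFrobSemisimplificationOf hs w, ← det_ρ_eq_of_isFrobSemisimplificationOf hs' w]
      exact det_ρ_eq_of_isEquivalent e w)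
  have hrr' : r.IsEquivalent r' := isEquivalent_of_det_ρ_eq hdet
  -- `ρ₂|Γ_{K_{v₀}}` is a frame change of the cyclotomic character, which is not locally unramified
  haveI := LocalField.charZero_adicCompletion v₀
  have hρ₂v : FramedGaloisRep.toLocal v₀ ρ₂ =
      FramedRep.conj P (FramedGaloisRep.cyclotomicPadicAlgCl (v₀.adicCompletion K) ℓ) := by
    rw [hP, FramedGaloisRep.toLocal_conj, hρ₀, toLocal_cyclotomicPadicAlgCl]
  have hnu : ¬ FramedRep.IsLocallyUnramified (FramedGaloisRep.toLocal v₀ ρ₂) := by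
    rw [hρ₂v, PstSpecTwist.isLocallyUnramified_conj_iff]
    exact PstSpecTwist.not_isLocallyUnramified_cyclotomic
      (LocalField.valuation_adicCompletion_natCast_lt_one v₀ ℓ hv₀)
  -- `D` attaches `r` to it (frame invariance), `twistOff D 2` attaches `r'`: contradiction
  have hrD : (D ℓ v₀ hv₀).IsWeilDeligneOf (FramedGaloisRep.toLocal v₀ ρ₂) r := by
    rw [hρ₂v]
    refine (D ℓ v₀ hv₀).conj P _ r ?_
    rw [← toLocal_cyclotomicPadicAlgCl, ← hρ₀]
    exact hr hv₀
  exact PstSpecTwist.twistOff_disagree (D ℓ v₀ hv₀) _ hnu (PstSpecTwist.two_pow_ne_one Nat.one_pos)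
    r r' hrD (hr' hv₀) hrr'

/-- The pinned family meets clause (F2) above every `ℓ` (under `FontaineDatumExists`). [folklore] -/
theorem pstFamily_isDeRhamFramed_cyclotomic (hE : FontaineDatumExists) (ℓ : ℕ) [Fact ℓ.Prime]
    (v : HeightOneSpectrum (𝓞 K)) (hv : ((ℓ : ℕ) : 𝓞 K) ∈ v.asIdeal) :
    (pstFamily K ℓ v hv).IsDeRhamFramed (FramedGaloisRep.cyclotomicPadicAlgCl (v.adicCompletion K) ℓ) := by
  haveI := LocalField.charZero_adicCompletion v
  exact (isFontaineDatum_fontainePstAdicCompletion hE v ℓ hv).cyclotomicWeightNegOne.isDeRhamFramed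

/-- The twisted pin meets every clause of Fontaine's specification wherever the pin does: it is an
admissible value of the `ε`-term `fontainePst`. [folklore] -/
theorem isFontaineDatum_twistFamily_pstFamily (hE : FontaineDatumExists) (ℓ : ℕ) [Fact ℓ.Prime]
    (v : HeightOneSpectrum (𝓞 K)) (hv : ((ℓ : ℕ) : 𝓞 K) ∈ v.asIdeal) :
    haveI := LocalField.charZero_adicCompletion v
    IsFontaineDatum (LocalField.valuation_adicCompletion_natCast_lt_one v ℓ hv)
      (twistFamily (pstFamily K) ℓ v hv) := by
  haveI := LocalField.charZero_adicCompletion v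
  exact PstSpecTwist.isFontaineDatum_twistOff (isFontaineDatum_fontainePstAdicCompletion hE v ℓ hv) _

/-- **The summit for `GL₁` and its twin with the twisted pin are not both true** (every `K`, all
`𝓡`, under `FontaineDatumExists`). [folklore] -/
theorem not_glc_and_glcWith_twist_pstFamily (hE : FontaineDatumExists) (𝓡 : ReciprocityData K)
    (hcpt : isCompact_glFiniteIntegralLevel 1 K) :
    ¬ (GlobalLanglandsCorrespondenceGLn 1 K 𝓡 hcpt ∧ GLCWith 1 K (twistFamily (pstFamily K)) 𝓡 hcpt) := by
  rintro ⟨h₁, h₂⟩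
  obtain ⟨v₀, hv₀⟩ := exists_natCast_mem_asIdeal K 2
  exact not_galoisToAutomorphicWith_and_automorphicToGaloisWith_twist 𝓡 hcpt (pstFamily K) 2 v₀ hv₀
    (pstFamily_isDeRhamFramed_cyclotomic hE 2)
    ⟨h₁.2, h₂.1⟩

/-- **`Langlands` and `LanglandsWith (twist ∘ pst)` are not both true** (under `FontaineDatumExists`),
although both pins satisfy every clause of `IsFontaineDatum`
(`isFontaineDatum_twistFamily_pstFamily`). [folklore] -/
theorem not_langlands_and_langlandsWith_twist (hE : FontaineDatumExists) :
    ¬ (Langlands ∧ LanglandsWith (fun K _ _ => twistFamily (pstFamily K))) := by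
  rintro ⟨h₁, h₂⟩
  obtain ⟨⟨𝓡⟩, h₁'⟩ := h₁ ℚ
  obtain ⟨-, h₂'⟩ := h₂ ℚ
  have hcpt : isCompact_glFiniteIntegralLevel 1 ℚ := isCompact_glFiniteIntegralLevel_holds 1 ℚ
  exact not_glc_and_glcWith_twist_pstFamily hE 𝓡 hcpt
    ⟨h₁' 𝓡 1 Nat.one_pos hcpt, h₂' 𝓡 1 Nat.one_pos hcpt⟩

end Main

end PinExclusion
end Summit.Langlands.Langlands.Theorems

end
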